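import Mathlib
import HarnessLib

/-!
# Route `ByReductionTypeAtTwo` (rung K4), crux `SupersingularRankZeroAtTwo` (item stmt-BirchSwinnertonDyer-19097), line
# `odd_blind_package` v2.20 → v2.21, stub 2/5 — **SATURATION AT A PRIME IN A CYCLIC FREE MODULE**: the algebra that turns the x-FREE
# invariant (α) «∃ e ∈ 𝐇¹, Col♭(L e) ∉ 2Λ» (μ-primitivity of the ♭ Coleman image of the global Iwasawa cohomology) into ♭-PRIMITIVITY OF A
# 2-SATURATED MEMBER of any family of classes (the `hprim` of tower-1's (U-inv) door `SSFlatERL.flatF3_package_of_levelCongruences_of_flatPrimitive`)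
# (cell `bsd-2adic`, seat `bsd-2adic-ss-1` GEN 26 = LEAD of 19097; `--supports 19097`, helper)

HONEST FRAMING (D-0054): THEOREMS ONLY — no definition, no named fact, no instance, no notation, no `sorry`.  Pure commutative algebra
(folklore): in a module `M = R·e₀` over a domain with well-founded divisibility, every non-zero `x` is `r^c • x'` with `φ x' ∉ (r)` as soon as
SOME element has `φ`-value outside the prime `(r)`; and a free module of rank `≤ 1` is cyclic.  Used at `R = Λ = ℤ₂⟦T⟧`, `r = C 2`, `M = I.H`
(free on the habitat: `Kato2004.IwasawaH1Data.moduleFree_of_torsionBy_eq_bot`; rank `≤ 1`: Kato 12.4), `φ = Col♭ ∘ L`.  Closes NO stub; 19097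
stays OPEN on its 5 registered stubs (v2.20 39efd4f3); nothing booked; BSD₂ is proved for no supersingular curve and BSD for no curve by any of this.

References: [BourbakiAC5to7] Ch. VII §1 no. 3, §4 no. 2 (saturation, content at a prime); [Kato2004Asterisque] §13.14 (p. 234).
-/

set_option autoImplicit false
-- the Theorems namespace of this sub repeats the summit name by design (D-0017 nested layout)
set_option linter.dupNamespace false

namespace Summit.BirchSwinnertonDyer.BirchSwinnertonDyer.Theorems

namespace SSFlatFold

/-- **A free module of rank `≤ 1` is cyclic**: some `e₀` with `∀ x, ∃ ξ, x = ξ • e₀`. [folklore] [cite: BourbakiAC5to7, Ch. II §1 no. 11] -/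
theorem exists_generator_of_free_of_rank_le_one {R : Type*} [CommRing R] [Nontrivial R] {M : Type*} [AddCommGroup M] [Module R M]
    [Module.Free R M] (h : Module.rank R M ≤ 1) : ∃ e₀ : M, ∀ x : M, ∃ ξ : R, x = ξ • e₀ := by
  let b := Module.Free.chooseBasis R M
  have hcard : Cardinal.mk (Module.Free.ChooseBasisIndex R M) ≤ 1 := by
    rw [← Module.Free.rank_eq_card_chooseBasisIndex]; exact h
  haveI : Subsingleton (Module.Free.ChooseBasisIndex R M) := Cardinal.le_one_iff_subsingleton.mp hcard
  rcases isEmpty_or_nonempty (Module.Free.ChooseBasisIndex R M) with hι | ⟨⟨i⟩⟩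
  · -- empty basis: `M` is trivial
    haveI : Subsingleton M := b.repr.toEquiv.subsingleton
    exact ⟨0, fun x ↦ ⟨0, Subsingleton.elim _ _⟩⟩
  · letI : Unique (Module.Free.ChooseBasisIndex R M) := ⟨⟨i⟩, fun j ↦ Subsingleton.elim _ _⟩
    refine ⟨b default, fun x ↦ ⟨b.repr x default, ?_⟩⟩
    conv_lhs => rw [← b.repr.symm_apply_apply x, Finsupp.unique_single (b.repr x)]
    rw [Module.Basis.repr_symm_single]

/-- ★ **Saturation at a prime with a primitive witness.**  `R` a domain with well-founded divisibility, `r` prime, `M = R·e₀` cyclic,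
`φ : M →ₗ R`; if SOME `e ∈ M` has `φ e ∉ (r)` then every `x ≠ 0` is `r^c • x'` with `φ x' ∉ (r)` — write `x = ξ•e₀`, `ξ = r^c·ξ'` with `r ∤ ξ'`
(`WfDvdMonoid.max_power_factor`), and `φ e₀ ∉ (r)` because `φ e = η·φ e₀ ∉ (r)`. [folklore] [cite: BourbakiAC5to7, Ch. VII §1 no. 3]
[cite: Kato2004Asterisque, §13.14 (p. 234)] -/
theorem exists_pow_smul_of_exists_not_mem {R : Type*} [CommRing R] [IsDomain R] [WfDvdMonoid R] {M : Type*} [AddCommGroup M]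
    [Module R M] {r : R} (hr : Prime r) {e₀ : M} (hgen : ∀ x : M, ∃ ξ : R, x = ξ • e₀) (φ : M →ₗ[R] R)
    (hα : ∃ e : M, φ e ∉ Ideal.span {r}) {x : M} (hx : x ≠ 0) :
    ∃ (c : ℕ) (x' : M), x = r ^ c • x' ∧ φ x' ∉ Ideal.span {r} := by
  -- `φ e₀ ∉ (r)`
  have h0 : φ e₀ ∉ Ideal.span {r} := by
    obtain ⟨e, he⟩ := hα
    obtain ⟨η, rfl⟩ := hgen e
    intro hmem
    exact he (by rw [map_smul, smul_eq_mul]; exact Ideal.mul_mem_left _ η hmem)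
  obtain ⟨ξ, rfl⟩ := hgen x
  have hξ : ξ ≠ 0 := by rintro rfl; exact hx (zero_smul R e₀)
  obtain ⟨c, ξ', hndvd, hξeq⟩ := WfDvdMonoid.max_power_factor hξ hr.irreducible
  refine ⟨c, ξ' • e₀, by rw [hξeq, mul_smul], ?_⟩
  rw [map_smul, smul_eq_mul, Ideal.mem_span_singleton]
  intro hdvd
  rcases hr.dvd_or_dvd hdvd with h | h
  · exact hndvd h
  · exact h0 (Ideal.mem_span_singleton.mpr h)

/-- **The same from freeness of rank `≤ 1`** (the habitat case: `𝐇¹(T₂E)` is Λ-free — `Kato2004.IwasawaH1Data.moduleFree_of_torsionBy_eq_bot` —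
of rank `≤ 1` — Kato 12.4). [folklore] [cite: Kato2004Asterisque, Thm. 12.4 (2), §13.14 (p. 234)] -/
theorem exists_pow_smul_of_exists_not_mem_of_free {R : Type*} [CommRing R] [IsDomain R] [WfDvdMonoid R] {M : Type*} [AddCommGroup M]
    [Module R M] [Module.Free R M] (hrank : Module.rank R M ≤ 1) {r : R} (hr : Prime r) (φ : M →ₗ[R] R)
    (hα : ∃ e : M, φ e ∉ Ideal.span {r}) {x : M} (hx : x ≠ 0) :
    ∃ (c : ℕ) (x' : M), x = r ^ c • x' ∧ φ x' ∉ Ideal.span {r} := by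
  obtain ⟨e₀, hgen⟩ := exists_generator_of_free_of_rank_le_one (R := R) (M := M) hrank
  exact exists_pow_smul_of_exists_not_mem hr hgen φ hα hx

/-- **Primitivity is inherited by the saturated element and products stay outside `(r)`**: if `φ x' ∉ (r)` and `a ∉ (r)` then
`a * φ x' ∉ (r)` (`(r)` is prime) — the form in which a multiplier `A ∉ (2)` and a ♭-primitive class combine. [folklore] -/
theorem mul_not_mem_span_singleton_of_prime {R : Type*} [CommRing R] {r a b : R} (hr : Prime r)
    (ha : a ∉ Ideal.span {r}) (hb : b ∉ Ideal.span {r}) : a * b ∉ Ideal.span {r} := by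
  rw [Ideal.mem_span_singleton] at ha hb ⊢
  exact fun h ↦ (hr.dvd_or_dvd h).elim ha hb

end SSFlatFold

end Summit.BirchSwinnertonDyer.BirchSwinnertonDyer.Theorems
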